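import Summits.QuantumFields.BalabanUV.Beta.RootedJetDictionary
import Summits.QuantumFields.BalabanUV.Beta.RootedMixedJetReflectionLaw

/-!
# `BalabanUV.Beta.RootedMixedJetContact` — THE CONTACT JETS AND THE COMMUTATOR OF THE MIXED REFLECTION LAWS, IN COUNTS
# (β sub-cell, row D1 letter chain HR-W-LET, MIXED sub-chain M3b toward the level-0 mixed identity (M₀); an3 gen 33)

HONEST FRAMING (cell charter, verbatim): «discharging BetaPertH makes Bałaban's UV stability UNCONDITIONAL — a real
constructive-QFT result; it is NOT the continuum limit and NOT the Clay problem.»  HONEST DEPENDENCY (verbatim): «continuum YM on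
T⁴ ⇐ BetaPertH ∧ nine spine estimates (0/9 proved); BetaPertH ⇐ (D1) ∧ (D4) ∧ CAP+tail; G-an2-4 gates asym, D1 and NE2/3/4.»
DERIVED cell leaf: [folklore] ring∕letter algebra over node 12b `AveragingMixedJetTables` (`PhiGAt ρ`, `PhiMAt ρ`, `MjetAt ρ`), leaf-05-g7's
`RootedMixedChartReflection` (MX1: `GmL`, `GmbL`, `PhiMLAt`, `BR`, `PhiMLAt_reflPair_self_eq_invT`) and `TruncatedNil4Calculus`
(`logT_invT`, `invT_invT`, `nil4_augR`), an3-g33's `RootedMixedJetLinear` (33M1: `MσGAt`), `RootedMixedJetReflectionLaw` (33M2: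
`MjetAt_sref_of_ne`, `MjetAt_bref_self`, `c11_MσGAt_DR`, `DR = τ₁·D1R + τ₂·D2R + τ₁τ₂·D12R`) and `RootedJetDictionary` (33M3a:
`c11_logT_PhiGAt_Y`, `c11_logT_PhiGAt_Zf`, `PhiGAt_X1`), all BY NAME.  No statement of Bałaban's papers is typed, no `[cite:]`, no `Prop` is
minted, no binder of the β-function wall (`hW`/`hR`/`D1Tel`/`D1Rep`, (D1), `BetaPertH`) is instantiated or discharged.  NOT summit progress.

## What this module proves (any root `ρ` in §1–§3; `ρ = ctr d L`, `L` odd in §4–§5; `(L : 𝕜) ≠ 0`, `(2 : 𝕜) ≠ 0` where stated)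

* §1 THE TWO SHADOW PROJECTIONS `piW`, `piV : Rho 𝔸 →ₐ[𝕜] Tau 𝔸` (keep `τ₁` resp. `τ₂` of the group part and move `σ` into
  node 12's fluctuation slot) and the augmented shadow `mapDual Tau.aug : Rho 𝔸 →ₐ DualNumber 𝔸`; they send MX1's left-chart letters
  `GmL (Zf w v) (upF D)`, `GmbL (Zb w v) (upF D)` to node 12's shadow letters `Yf w D`, `Yb w D` (resp. `Yf v D`, `Yb v D`; `X1 D`, `X1b D`).
* §2 **THE CONTACT JETS IN COUNTS**: for the un-normalised two-background σ-jet of 33M1 at the trivial reference,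
  `c10 (MσGAt (Zf w v) (Zb w v) (upF D) (Zf 0 0) (Zb 0 0) 0) = (2L^d)⁻¹ • (hessUAt ρ w D + linAvgAt ρ [w, D])`,
  `c01 (…) = (2L^d)⁻¹ • (hessUAt ρ v D + linAvgAt ρ [v, D])`, `c00 (…) = L^{-d} • linAvgAt ρ D`
  (33M3a's one-parameter computation through §1).
* §3 THE GROUP PART AND THE REFERENCE IN COUNTS: `c11 (logT Φ^M(W,V,B)).fst = (2L^d)⁻¹ • hessUAt ρ W V` and
  `Φ^M(0,0,B).snd = ι (L^{-d} • linAvgAt ρ B)`.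
* §4 THE PULL-BACK TO THE ORIGINAL SIDE on the axis (`μ = α`, `y′ = bref α α y`, `w, v, b̃ = R1g α W, R1g α V, R1g α B`):
  `Φ^M_{(α,y′)}(W,V,B) = invT Φ^L_{(α,y)}(Zf w v, Zb w v, BR)`, hence
  `c11 (logT Φ^M_{(α,y′)}).fst = −(2L^d)⁻¹ • hessUAt ρ_c w v (α,y)`,
  `Φ^M_{(α,y′)}(0,0,B).snd = −ι(L^{-d} • linAvgAt ρ_c b̃ (α,y))`, and **THE COMMUTATOR OF 33M2's LONGITUDINAL LAW IS
  `[(2L^d)⁻¹ • hessUAt ρ_c w v, L^{-d} • linAvgAt ρ_c b̃]`** (`c11_comm_bref_self`).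
* §5 **THE TWO AXIS-REFLECTION LAWS OF NODE 12b's ROOTED MIXED JET `MjetAt` WITH ALL CORRECTIONS IN COUNTS**
  (`MjetAt_sref_of_ne_counts`, `MjetAt_bref_self_counts`): pulled-back jet + `(2L^d)⁻¹ • (hessUAt ρ_c v D1R + linAvgAt ρ_c [v, D1R])`
  `+ (2L^d)⁻¹ • (hessUAt ρ_c w D2R + linAvgAt ρ_c [w, D2R]) + L^{-d} • linAvgAt ρ_c D12R` (transverse), and MINUS the same PLUS
  the commutator of §4 (longitudinal).

## What is NOT here
No evaluation at single letters (M3c: MX3's `R1g_single`, node 7aρ's `hessUAt_single`∕`linAvgAt_single`), no table (`tTab`,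
`mixKerAt`), no packed identity (`hM_an1`, leaf-05-g7's `MixedLetterPacking`∕`MixedLetterUnpacking`), no kernel (`hessFFAt`,
`linKerAt`, `ctGen`).
-/

namespace Summit.QuantumFields.BalabanUV.Beta.RootedMixedJetContact

open Finset
open Literature.MathematicalPhysics.QuantumFieldTheory.Balaban1983to89
open Literature.MathematicalPhysics.QuantumFieldTheory.Balaban1983to89.Beta
open AffineAveraging (Form1 box)
open AveragingContoursRooted (ctr linAvgAt loopCAt)
open AveragingHessianKernels (bw)
open AveragingHessianKernelsRooted (hessUAt)
open AveragingThirdJet (Tau Rho dmk fst_dmk snd_dmk dfst_mul dsnd_mul upF upF_apply logT invT map_logT map_invT invT_one logT_one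
  ι_zero mapDual fst_mapDual snd_mapDual X1 X1b Yf Yb logT_dmk_one augR augR_apply)
open AveragingThirdJet.Tau (τ₁ τ₂ τ12 ι c00 c10 c01 c11 mk ext4 c11_add c11_neg c11_smul aug aug_apply ιHom ιHom_apply c11_mul_ι
  c11_ι_mul)
open AveragingMixedJetTables (PhiGAt map_PhiGAt PhiGAt_one Zf Zb Gm Gmb PhiMAt MjetAt)
open ResolventReflection (sref bref)
open Summit.QuantumFields.BalabanUV.Beta.RootedHolonomyReflection (R1g)
open Summit.QuantumFields.BalabanUV.Beta.RootedHolonomyReflectionHol (reflPair)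
open Summit.QuantumFields.BalabanUV.Beta.TruncatedNil4Calculus (nil4_augR aug_PhiGAt_eq_one logT_invT invT_invT aug_invT_eq_one)
open Summit.QuantumFields.BalabanUV.Beta.RootedMixedChartReflection (GmL GmbL PhiMLAt fst_GmL snd_GmL fst_GmbL snd_GmbL
  PhiMAt_eq_PhiMLAt BR reflPair_Zf_Zb reflPair_Zb_Zf PhiMLAt_reflPair_self_eq_invT augR_Gm augR_Gmb)
open Summit.QuantumFields.BalabanUV.Beta.RootedMixedJetLinear (MσGAt MσGAt_one_one_zero)
open Summit.QuantumFields.BalabanUV.Beta.RootedMixedJetReflectionLaw (Zf_zero Zb_zero R1g_zero BR_zero_zero DR D1R D2R D12R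
  fst_PhiMLAt fst_PhiMAt fst_PhiMAt_zero_zero fst_logT snd_invT_of_fst_eq_one MjetAt_sref_of_ne MjetAt_bref_self c11_MσGAt_DR)
open Summit.QuantumFields.BalabanUV.Beta.RootedJetDictionary (PhiGAt_X1 inv_smul_sum_box_loopCAt c11_logT_PhiGAt_Y
  c11_logT_PhiGAt_Zf)

variable {𝕜 : Type*} [Field 𝕜] {d : ℕ} {𝔸 : Type*} [Ring 𝔸] [Algebra 𝕜 𝔸]

/-! ## §1 The shadow projections and the images of the left-chart letters -/

/-- [folklore] THE `τ₁`-SHADOW `Rho 𝔸 → Tau 𝔸`: keep the `τ₁`-component of both parts, send the group part to node 12's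
background slot and the `σ`-part to node 12's fluctuation slot (`(Z, S) ↦ (c00 Z) + τ₁·(c00 S) + τ₂·(c10 Z) + τ₁τ₂·(c10 S)`). -/
def piW : Rho 𝔸 →ₐ[𝕜] Tau 𝔸 where
  toFun r := mk (c00 r.fst) (c00 r.snd) (c10 r.fst) (c10 r.snd)
  map_one' := ext4 (by simp) (by simp) (by simp) (by simp)
  map_mul' r r' := ext4 (by simp) (by simp) (by simp) (by simp; abel)
  map_zero' := ext4 (by simp) (by simp) (by simp) (by simp)
  map_add' r r' := ext4 (by simp) (by simp) (by simp) (by simp)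
  commutes' c := ext4 (by simp [Algebra.algebraMap_eq_smul_one]) (by simp [Algebra.algebraMap_eq_smul_one])
    (by simp [Algebra.algebraMap_eq_smul_one]) (by simp [Algebra.algebraMap_eq_smul_one])

/-- [folklore] Evaluation of `piW`. -/
@[simp] theorem piW_apply (r : Rho 𝔸) : piW (𝕜 := 𝕜) r = mk (c00 r.fst) (c00 r.snd) (c10 r.fst) (c10 r.snd) := rfl

/-- [folklore] THE `τ₂`-SHADOW `Rho 𝔸 → Tau 𝔸` (same with the `τ₂`-components). -/
def piV : Rho 𝔸 →ₐ[𝕜] Tau 𝔸 where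
  toFun r := mk (c00 r.fst) (c00 r.snd) (c01 r.fst) (c01 r.snd)
  map_one' := ext4 (by simp) (by simp) (by simp) (by simp)
  map_mul' r r' := ext4 (by simp) (by simp) (by simp) (by simp; abel)
  map_zero' := ext4 (by simp) (by simp) (by simp) (by simp)
  map_add' r r' := ext4 (by simp) (by simp) (by simp) (by simp)
  commutes' c := ext4 (by simp [Algebra.algebraMap_eq_smul_one]) (by simp [Algebra.algebraMap_eq_smul_one])
    (by simp [Algebra.algebraMap_eq_smul_one]) (by simp [Algebra.algebraMap_eq_smul_one])

/-- [folklore] Evaluation of `piV`. -/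
@[simp] theorem piV_apply (r : Rho 𝔸) : piV (𝕜 := 𝕜) r = mk (c00 r.fst) (c00 r.snd) (c01 r.fst) (c01 r.snd) := rfl

/-- [folklore] `piW` sends the forward left-chart letter `GmL (Zf w v) (upF D)` to node 12's forward shadow letter `Yf w D`. -/
theorem piW_GmL_Zf (w v D : Form1 d 𝔸) (κ : Fin d) (x : Fin d → ℤ) :
    piW (𝕜 := 𝕜) (GmL (Zf 𝕜 w v) (upF D) κ x) = Yf w D κ x :=
  ext4 (by simp [Zf, Yf]) (by simp [Zf, Yf]) (by simp [Zf, Yf]) (by simp [Zf, Yf])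

/-- [folklore] … and the backward letter `GmbL (Zb w v) (upF D)` to `Yb w D`. -/
theorem piW_GmbL_Zb (w v D : Form1 d 𝔸) (κ : Fin d) (x : Fin d → ℤ) :
    piW (𝕜 := 𝕜) (GmbL (Zb 𝕜 w v) (upF D) κ x) = Yb w D κ x :=
  ext4 (by simp [Zb, Yb]) (by simp [Zb, Yb]) (by simp [Zb, Yb]) (by simp [Zb, Yb])

/-- [folklore] `piV` sends `GmL (Zf w v) (upF D)` to `Yf v D`. -/
theorem piV_GmL_Zf (w v D : Form1 d 𝔸) (κ : Fin d) (x : Fin d → ℤ) :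
    piV (𝕜 := 𝕜) (GmL (Zf 𝕜 w v) (upF D) κ x) = Yf v D κ x :=
  ext4 (by simp [Zf, Yf]) (by simp [Zf, Yf]) (by simp [Zf, Yf]) (by simp [Zf, Yf])

/-- [folklore] … and `GmbL (Zb w v) (upF D)` to `Yb v D`. -/
theorem piV_GmbL_Zb (w v D : Form1 d 𝔸) (κ : Fin d) (x : Fin d → ℤ) :
    piV (𝕜 := 𝕜) (GmbL (Zb 𝕜 w v) (upF D) κ x) = Yb v D κ x :=
  ext4 (by simp [Zb, Yb]) (by simp [Zb, Yb]) (by simp [Zb, Yb]) (by simp [Zb, Yb])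

/-- [folklore] The augmented shadow sends `GmL (Zf w v) (upF D)` to node 12's first-order letter `X1 D`. -/
theorem aug_GmL_Zf (w v D : Form1 d 𝔸) (κ : Fin d) (x : Fin d → ℤ) :
    mapDual (aug (𝕜 := 𝕜)) (GmL (Zf 𝕜 w v) (upF D) κ x) = X1 D κ x :=
  TrivSqZeroExt.ext (by simp [Zf, X1]) (by simp [Zf, X1])

/-- [folklore] … and `GmbL (Zb w v) (upF D)` to `X1b D`. -/
theorem aug_GmbL_Zb (w v D : Form1 d 𝔸) (κ : Fin d) (x : Fin d → ℤ) :
    mapDual (aug (𝕜 := 𝕜)) (GmbL (Zb 𝕜 w v) (upF D) κ x) = X1b D κ x :=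
  TrivSqZeroExt.ext (by simp [Zb, X1b]) (by simp [Zb, X1b])

/-! ## §2 The contact jets in counts -/

/-- [folklore] **THE `τ₁σ`-CONTACT JET IN COUNTS**: `c10 (MσGAt (Zf w v) (Zb w v) (upF D) (Zf 0 0) (Zb 0 0) 0)`
`= (2L^d)⁻¹ • (hessUAt ρ w D + linAvgAt ρ [w, D])` (the `piW`-shadow of the left chart is node 12's shadow chart `Y(w; D)`; 33M3a
`c11_logT_PhiGAt_Y`). -/
theorem c10_MσGAt_contact (ρ : Fin d → ℤ) (w v D : Form1 d 𝔸) {L : ℕ} (hL : (L : 𝕜) ≠ 0) (h2 : (2 : 𝕜) ≠ 0) (μ : Fin d)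
    (y : Fin d → ℤ) :
    c10 (MσGAt 𝕜 ρ (Zf 𝕜 w v) (Zb 𝕜 w v) (upF D) (Zf 𝕜 0 0) (Zb 𝕜 0 0) 0 L μ y)
      = ((2 : 𝕜) * (L : 𝕜) ^ d)⁻¹ • (hessUAt ρ w D L μ y + linAvgAt ρ (bw w D) L μ y) := by
  rw [Zf_zero, Zb_zero, MσGAt_one_one_zero]
  have e1 : (fun κ x => piW (𝕜 := 𝕜) (GmL (Zf 𝕜 w v) (upF D) κ x)) = Yf w D := by
    funext κ x; exact piW_GmL_Zf w v D κ x
  have e2 : (fun κ x => piW (𝕜 := 𝕜) (GmbL (Zb 𝕜 w v) (upF D) κ x)) = Yb w D := by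
    funext κ x; exact piW_GmbL_Zb w v D κ x
  have key : c11 (piW (𝕜 := 𝕜) (logT 𝕜 (PhiMLAt 𝕜 ρ (Zf 𝕜 w v) (Zb 𝕜 w v) (upF D) L μ y)))
      = c11 (logT 𝕜 (PhiGAt 𝕜 ρ (Yf w D) (Yb w D) L μ y)) := by
    rw [map_logT, PhiMLAt, map_PhiGAt, e1, e2]
  rw [← c11_logT_PhiGAt_Y ρ w D hL h2 μ y, ← key, piW_apply, Tau.c11_mk]

/-- [folklore] **THE `τ₂σ`-CONTACT JET IN COUNTS**: `c01 (…) = (2L^d)⁻¹ • (hessUAt ρ v D + linAvgAt ρ [v, D])`. -/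
theorem c01_MσGAt_contact (ρ : Fin d → ℤ) (w v D : Form1 d 𝔸) {L : ℕ} (hL : (L : 𝕜) ≠ 0) (h2 : (2 : 𝕜) ≠ 0) (μ : Fin d)
    (y : Fin d → ℤ) :
    c01 (MσGAt 𝕜 ρ (Zf 𝕜 w v) (Zb 𝕜 w v) (upF D) (Zf 𝕜 0 0) (Zb 𝕜 0 0) 0 L μ y)
      = ((2 : 𝕜) * (L : 𝕜) ^ d)⁻¹ • (hessUAt ρ v D L μ y + linAvgAt ρ (bw v D) L μ y) := by
  rw [Zf_zero, Zb_zero, MσGAt_one_one_zero]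
  have e1 : (fun κ x => piV (𝕜 := 𝕜) (GmL (Zf 𝕜 w v) (upF D) κ x)) = Yf v D := by
    funext κ x; exact piV_GmL_Zf w v D κ x
  have e2 : (fun κ x => piV (𝕜 := 𝕜) (GmbL (Zb 𝕜 w v) (upF D) κ x)) = Yb v D := by
    funext κ x; exact piV_GmbL_Zb w v D κ x
  have key : c11 (piV (𝕜 := 𝕜) (logT 𝕜 (PhiMLAt 𝕜 ρ (Zf 𝕜 w v) (Zb 𝕜 w v) (upF D) L μ y)))
      = c11 (logT 𝕜 (PhiGAt 𝕜 ρ (Yf v D) (Yb v D) L μ y)) := by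
    rw [map_logT, PhiMLAt, map_PhiGAt, e1, e2]
  rw [← c11_logT_PhiGAt_Y ρ v D hL h2 μ y, ← key, piV_apply, Tau.c11_mk]

/-- [folklore] **THE `σ`-CONTACT JET IN COUNTS** (order `0` in the group directions): `c00 (…) = L^{-d} • linAvgAt ρ D`
(the augmented shadow is node 12's first-order chart `X1 D`; 33M3a `PhiGAt_X1`). -/
theorem c00_MσGAt_contact (ρ : Fin d → ℤ) (w v D : Form1 d 𝔸) {L : ℕ} (hL : (L : 𝕜) ≠ 0) (μ : Fin d) (y : Fin d → ℤ) :
    c00 (MσGAt 𝕜 ρ (Zf 𝕜 w v) (Zb 𝕜 w v) (upF D) (Zf 𝕜 0 0) (Zb 𝕜 0 0) 0 L μ y)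
      = ((L : 𝕜) ^ d)⁻¹ • linAvgAt ρ D L μ y := by
  rw [Zf_zero, Zb_zero, MσGAt_one_one_zero]
  have e1 : (fun κ x => mapDual (aug (𝕜 := 𝕜)) (GmL (Zf 𝕜 w v) (upF D) κ x)) = X1 D := by
    funext κ x; exact aug_GmL_Zf w v D κ x
  have e2 : (fun κ x => mapDual (aug (𝕜 := 𝕜)) (GmbL (Zb 𝕜 w v) (upF D) κ x)) = X1b D := by
    funext κ x; exact aug_GmbL_Zb w v D κ x
  have key : (mapDual (aug (𝕜 := 𝕜)) (logT 𝕜 (PhiMLAt 𝕜 ρ (Zf 𝕜 w v) (Zb 𝕜 w v) (upF D) L μ y))).snd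
      = (logT 𝕜 (PhiGAt 𝕜 ρ (X1 D) (X1b D) L μ y)).snd := by
    rw [map_logT, PhiMLAt, map_PhiGAt, e1, e2]
  rw [snd_mapDual, aug_apply] at key
  rw [key, PhiGAt_X1, logT_dmk_one, snd_dmk, inv_smul_sum_box_loopCAt ρ D hL μ y, add_sub_cancel]

/-! ## §3 The group part and the reference background in counts -/

/-- [folklore] THE GROUP PART: `c11 (logT Φ^M_ρ(W, V, B)).fst = (2L^d)⁻¹ • hessUAt ρ W V` (the group part of the mixed chart is the
symmetric chart `Φ^ρ(Zf W V, Zb W V)`; 33M3a `c11_logT_PhiGAt_Zf`). -/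
theorem c11_fst_logT_PhiMAt (ρ : Fin d → ℤ) (W V B : Form1 d 𝔸) {L : ℕ} (hL : (L : 𝕜) ≠ 0) (h2 : (2 : 𝕜) ≠ 0) (μ : Fin d)
    (y : Fin d → ℤ) :
    c11 (logT 𝕜 (PhiMAt 𝕜 ρ W V B L μ y)).fst = ((2 : 𝕜) * (L : 𝕜) ^ d)⁻¹ • hessUAt ρ W V L μ y := by
  rw [fst_logT, fst_PhiMAt, c11_logT_PhiGAt_Zf ρ W V hL h2 μ y]

/-- [folklore] THE REFERENCE BACKGROUND: `Φ^M_ρ(0, 0, B).snd = ι (L^{-d} • linAvgAt ρ B)` (its letters are the scalar images `ι(X1 B)`,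
`ι(X1b B)`; 33M3a `PhiGAt_X1`). -/
theorem snd_PhiMAt_zero_zero (ρ : Fin d → ℤ) (B : Form1 d 𝔸) {L : ℕ} (hL : (L : 𝕜) ≠ 0) (μ : Fin d) (y : Fin d → ℤ) :
    (PhiMAt 𝕜 ρ 0 0 B L μ y).snd = ι (((L : 𝕜) ^ d)⁻¹ • linAvgAt ρ B L μ y) := by
  have e1 : (fun κ x => mapDual (ιHom (𝕜 := 𝕜)) (X1 B κ x)) = Gm 𝕜 0 0 B := by
    funext κ x
    exact TrivSqZeroExt.ext (ext4 (by simp [X1, Gm, Zf]) (by simp [X1, Gm, Zf]) (by simp [X1, Gm, Zf]) (by simp [X1, Gm, Zf]))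
      (ext4 (by simp [X1, Gm, Zf]) (by simp [X1, Gm, Zf]) (by simp [X1, Gm, Zf]) (by simp [X1, Gm, Zf]))
  have e2 : (fun κ x => mapDual (ιHom (𝕜 := 𝕜)) (X1b B κ x)) = Gmb 𝕜 0 0 B := by
    funext κ x
    exact TrivSqZeroExt.ext (ext4 (by simp [X1b, Gmb, Zb]) (by simp [X1b, Gmb, Zb]) (by simp [X1b, Gmb, Zb]) (by simp [X1b, Gmb, Zb]))
      (ext4 (by simp [X1b, Gmb, Zb]) (by simp [X1b, Gmb, Zb]) (by simp [X1b, Gmb, Zb]) (by simp [X1b, Gmb, Zb]))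
  have key := map_PhiGAt (R := DualNumber 𝔸) (R' := Rho 𝔸) (mapDual (ιHom (𝕜 := 𝕜))) ρ (X1 B) (X1b B) L μ y
  rw [e1, e2] at key
  rw [PhiMAt, ← key, snd_mapDual, PhiGAt_X1, snd_dmk, inv_smul_sum_box_loopCAt ρ B hL μ y, add_sub_cancel, ιHom_apply]

/-! ## §4 The pull-back to the original side on the axis -/

section Longitudinal

variable {L : ℕ} (hL : Odd L) (h2 : (2 : 𝕜) ≠ 0)
include hL h2

/-- [folklore] `μ = α`: **THE MIXED AVERAGING AT THE PARTNER BOND IS THE INVERSE OF THE LEFT-CHART AVERAGING OF THE REFLECTED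
LETTERS** — MX1's `PhiMLAt_reflPair_self_eq_invT` solved for the original side (`invT_invT` in `Rho 𝔸`, `nil4_augR`). -/
theorem PhiMAt_bref_self_eq_invT (α : Fin d) (W V B : Form1 d 𝔸) (y : Fin d → ℤ) :
    PhiMAt 𝕜 (ctr d L) W V B L α (bref α α y)
      = invT (PhiMLAt 𝕜 (ctr d L) (Zf 𝕜 (R1g α W) (R1g α V)) (Zb 𝕜 (R1g α W) (R1g α V)) (BR (𝕜 := 𝕜) α W V B) L α y) := by
  have hΦ : augR 𝕜 (PhiMAt 𝕜 (ctr d L) W V B L α (bref α α y)) = 1 :=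
    aug_PhiGAt_eq_one (augR_Gm W V B) (augR_Gmb W V B) (ctr d L) L α _
  rw [← reflPair_Zf_Zb, ← reflPair_Zb_Zf, PhiMLAt_reflPair_self_eq_invT hL h2, invT_invT (nil4_augR (𝕜 := 𝕜)) hΦ]

/-- [folklore] `μ = α`: the left-chart averaging of the reflected letters is `≡ 1 mod 𝔪`. -/
theorem augR_PhiMLAt_refl (α : Fin d) (W V B : Form1 d 𝔸) (y : Fin d → ℤ) :
    augR 𝕜 (PhiMLAt 𝕜 (ctr d L) (Zf 𝕜 (R1g α W) (R1g α V)) (Zb 𝕜 (R1g α W) (R1g α V)) (BR (𝕜 := 𝕜) α W V B) L α y) = 1 := by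
  have hΦ : augR 𝕜 (PhiMAt 𝕜 (ctr d L) W V B L α (bref α α y)) = 1 :=
    aug_PhiGAt_eq_one (augR_Gm W V B) (augR_Gmb W V B) (ctr d L) L α _
  rw [← reflPair_Zf_Zb, ← reflPair_Zb_Zf, PhiMLAt_reflPair_self_eq_invT hL h2]
  exact aug_invT_eq_one hΦ

/-- [folklore] `μ = α`: **THE GROUP-PART LOGARITHM AT THE PARTNER BOND IS MINUS THE SYMMETRIC-CHART LOGARITHM OF THE REFLECTED
BACKGROUNDS** (`logT_invT` in `Rho 𝔸`, then `fst`). -/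
theorem fst_logT_PhiMAt_bref_self (α : Fin d) (W V B : Form1 d 𝔸) (y : Fin d → ℤ) :
    (logT 𝕜 (PhiMAt 𝕜 (ctr d L) W V B L α (bref α α y))).fst
      = -logT 𝕜 (PhiGAt 𝕜 (ctr d L) (Zf 𝕜 (R1g α W) (R1g α V)) (Zb 𝕜 (R1g α W) (R1g α V)) L α y) := by
  rw [PhiMAt_bref_self_eq_invT hL h2, logT_invT (nil4_augR (𝕜 := 𝕜)) h2 (augR_PhiMLAt_refl hL h2 α W V B y),
    TrivSqZeroExt.fst_neg, fst_logT, fst_PhiMLAt]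

/-- [folklore] `μ = α`, IN COUNTS: `c11 (logT Φ^M_{(α, bref α α y)}(W, V, B)).fst = −(2L^d)⁻¹ • hessUAt ρ_c w v (α, y)`. -/
theorem c11_fst_logT_PhiMAt_bref_self (hL0 : (L : 𝕜) ≠ 0) (α : Fin d) (W V B : Form1 d 𝔸) (y : Fin d → ℤ) :
    c11 (logT 𝕜 (PhiMAt 𝕜 (ctr d L) W V B L α (bref α α y))).fst
      = -(((2 : 𝕜) * (L : 𝕜) ^ d)⁻¹ • hessUAt (ctr d L) (R1g α W) (R1g α V) L α y) := by
  rw [fst_logT_PhiMAt_bref_self hL h2, c11_neg, c11_logT_PhiGAt_Zf _ _ _ hL0 h2]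

/-- [folklore] `μ = α`, IN COUNTS: `Φ^M_{(α, bref α α y)}(0, 0, B).snd = −ι (L^{-d} • linAvgAt ρ_c b̃ (α, y))`. -/
theorem snd_PhiMAt_zero_zero_bref_self (hL0 : (L : 𝕜) ≠ 0) (α : Fin d) (B : Form1 d 𝔸) (y : Fin d → ℤ) :
    (PhiMAt 𝕜 (ctr d L) 0 0 B L α (bref α α y)).snd = -ι (((L : 𝕜) ^ d)⁻¹ • linAvgAt (ctr d L) (R1g α B) L α y) := by
  rw [PhiMAt_bref_self_eq_invT hL h2, R1g_zero, BR_zero_zero, ← PhiMAt_eq_PhiMLAt,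
    snd_invT_of_fst_eq_one (fst_PhiMAt_zero_zero _ _ L α y), snd_PhiMAt_zero_zero _ _ hL0]

/-- [folklore] `μ = α`: **THE COMMUTATOR OF 33M2's LONGITUDINAL LAW IN COUNTS**:
`c11 [ (logT Φ).fst, Φ₀.snd ] = [ (2L^d)⁻¹ • hessUAt ρ_c w v (α,y), L^{-d} • linAvgAt ρ_c b̃ (α,y) ]`. -/
theorem c11_comm_bref_self (hL0 : (L : 𝕜) ≠ 0) (α : Fin d) (W V B : Form1 d 𝔸) (y : Fin d → ℤ) :
    c11 ((logT 𝕜 (PhiMAt 𝕜 (ctr d L) W V B L α (bref α α y))).fst * (PhiMAt 𝕜 (ctr d L) 0 0 B L α (bref α α y)).snd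
          - (PhiMAt 𝕜 (ctr d L) 0 0 B L α (bref α α y)).snd * (logT 𝕜 (PhiMAt 𝕜 (ctr d L) W V B L α (bref α α y))).fst)
      = AveragingHessianKernels.comm (((2 : 𝕜) * (L : 𝕜) ^ d)⁻¹ • hessUAt (ctr d L) (R1g α W) (R1g α V) L α y)
          (((L : 𝕜) ^ d)⁻¹ • linAvgAt (ctr d L) (R1g α B) L α y) := by
  rw [snd_PhiMAt_zero_zero_bref_self hL h2 hL0, mul_neg, neg_mul, sub_neg_eq_add, c11_add, c11_neg, c11_mul_ι, c11_ι_mul,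
    c11_fst_logT_PhiMAt_bref_self hL h2 hL0, AveragingHessianKernels.comm, neg_mul, mul_neg, neg_neg, sub_eq_add_neg]

end Longitudinal

/-! ## §5 The two axis-reflection laws of `MjetAt` with all corrections in counts -/

section Laws

variable {L : ℕ} (hL : Odd L) (h2 : (2 : 𝕜) ≠ 0) (hL0 : (L : 𝕜) ≠ 0)
include hL h2 hL0

/-- [folklore] **`μ ≠ α`: THE TRANSVERSE REFLECTION LAW OF NODE 12b's ROOTED MIXED JET, ALL CORRECTIONS IN COUNTS**
(`w, v, b̃ = R1g α W, R1g α V, R1g α B`; `D1R`, `D2R`, `D12R` = 33M2's components of the axis correction):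
`M(W,V;B)(μ, sref α y) = M(w,v;b̃)(μ,y) + (2L^d)⁻¹ • (hessUAt ρ_c v D1R + linAvgAt ρ_c [v, D1R])`
`+ (2L^d)⁻¹ • (hessUAt ρ_c w D2R + linAvgAt ρ_c [w, D2R]) + L^{-d} • linAvgAt ρ_c D12R` (all at `(μ, y)`). -/
theorem MjetAt_sref_of_ne_counts {α μ : Fin d} (h : μ ≠ α) (W V B : Form1 d 𝔸) (y : Fin d → ℤ) :
    MjetAt 𝕜 (ctr d L) W V B L μ (sref α y)
      = MjetAt 𝕜 (ctr d L) (R1g α W) (R1g α V) (R1g α B) L μ y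
        + ((2 : 𝕜) * (L : 𝕜) ^ d)⁻¹ • (hessUAt (ctr d L) (R1g α V) (D1R α W V B) L μ y
            + linAvgAt (ctr d L) (bw (R1g α V) (D1R α W V B)) L μ y)
        + ((2 : 𝕜) * (L : 𝕜) ^ d)⁻¹ • (hessUAt (ctr d L) (R1g α W) (D2R α W V B) L μ y
            + linAvgAt (ctr d L) (bw (R1g α W) (D2R α W V B)) L μ y)
        + ((L : 𝕜) ^ d)⁻¹ • linAvgAt (ctr d L) (D12R (𝕜 := 𝕜) α W V B) L μ y := by
  rw [MjetAt_sref_of_ne hL h2 h, c11_MσGAt_DR, c01_MσGAt_contact _ _ _ _ hL0 h2, c10_MσGAt_contact _ _ _ _ hL0 h2,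
    c00_MσGAt_contact _ _ _ _ hL0]
  simp only [add_assoc]

/-- [folklore] **`μ = α`: THE LONGITUDINAL REFLECTION LAW OF NODE 12b's ROOTED MIXED JET, ALL CORRECTIONS IN COUNTS**
(`y′ = bref α α y`): `M(W,V;B)(α, y′) = −( M(w,v;b̃)(α,y) + [the three contact terms of the transverse law at μ = α]`
`+ [ (2L^d)⁻¹ • hessUAt ρ_c w v (α,y), L^{-d} • linAvgAt ρ_c b̃ (α,y) ] )`. -/
theorem MjetAt_bref_self_counts (α : Fin d) (W V B : Form1 d 𝔸) (y : Fin d → ℤ) :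
    MjetAt 𝕜 (ctr d L) W V B L α (bref α α y)
      = -(MjetAt 𝕜 (ctr d L) (R1g α W) (R1g α V) (R1g α B) L α y
          + ((2 : 𝕜) * (L : 𝕜) ^ d)⁻¹ • (hessUAt (ctr d L) (R1g α V) (D1R α W V B) L α y
              + linAvgAt (ctr d L) (bw (R1g α V) (D1R α W V B)) L α y)
          + ((2 : 𝕜) * (L : 𝕜) ^ d)⁻¹ • (hessUAt (ctr d L) (R1g α W) (D2R α W V B) L α y
              + linAvgAt (ctr d L) (bw (R1g α W) (D2R α W V B)) L α y)
          + ((L : 𝕜) ^ d)⁻¹ • linAvgAt (ctr d L) (D12R (𝕜 := 𝕜) α W V B) L α y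
          + AveragingHessianKernels.comm (((2 : 𝕜) * (L : 𝕜) ^ d)⁻¹ • hessUAt (ctr d L) (R1g α W) (R1g α V) L α y)
              (((L : 𝕜) ^ d)⁻¹ • linAvgAt (ctr d L) (R1g α B) L α y)) := by
  rw [MjetAt_bref_self hL h2, c11_MσGAt_DR, c01_MσGAt_contact _ _ _ _ hL0 h2, c10_MσGAt_contact _ _ _ _ hL0 h2,
    c00_MσGAt_contact _ _ _ _ hL0, c11_comm_bref_self hL h2 hL0]
  simp only [add_assoc]

end Laws

end Summit.QuantumFields.BalabanUV.Beta.RootedMixedJetContact
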